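import Literature.Analysis.FluidPDE.AncientSimilarityVariables
import Literature.Analysis.FluidPDE.TypeIAncientMild
import Summits.NavierStokesRegularity.NavierStokesRegularity.Theorems.QuantisedSymmetryPolyhedralDssProfileExistsStubClassicalOfOseenMildPast
import HarnessLib

/-!
# A normalised Oseen-gauge DSS profile is a periodic equivariant Type-I orbit of the backward Leray
  system — crux stmt-NavierStokesRegularity-1404 (`QuantisedSymmetry.PolyhedralDssProfileExists`),
  line polyhedral_cell, stub `stub_lerayOrbitOfRepresentative`

Registered stub `stub_lerayOrbitOfRepresentative` (`--supports stmt-NavierStokesRegularity-1404`), the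
converse direction (at the level of the smooth Oseen-gauge representative) of the parked line `birth`:
let `V` be a field on the past in the KNSS class `IsTypeIAncientMild C V` (jointly smooth on
`(−∞, 0) × ℝ³`, divergence free, Oseen-mild, Type-I in time), exactly `c`-DSS (`c > 1`), with the
space–time Type-I bound `HasTypeIDecay C₀ V`, equivariant under a group `G` of linear isometries, and
nonzero at some `(t₀, x₀)` with `t₀ < 0`. Then in the backward similarity (Leray) variables
`U(s, y) = √(−t) V(t, x)`, `y = x/√(−t)`, `s = −log(−t)` — the tree's `U = lerayOrbit V`,
`P = lerayOrbitPressure p` for a pressure `p` making `V` classical on the past — the pair `(U, P)`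
is a classical solution of the autonomous backward Leray system
`∂ₛU + ½U + ½(y·∇)U + (U·∇)U + ∇P = ΔU`, `div U = 0` on `ℝ × ℝ³`, `U` is `2 log c`-periodic in `s`,
obeys the profile bound `(1 + ‖y‖) ‖U(s, y)‖ ≤ C₀`, is `G`-equivariant, and is not identically zero.

Proof (assembly of proved tree facts, Chae–Wolf 2017 §4 dictionary in `AncientSimilarityVariables`).
* pressure: `exists_isClassicalNSSolutionOn_Iio_of_isTypeIAncientMild` (p152134, this namespace);
* the system: `isClassicalNSSolutionOn_Iio_iff_isBackwardLeraySolutionOn`;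
* periodicity: `IsDiscretelySelfSimilar.periodic_lerayOrbit` (needs `0 < c`, from `1 < c`);
* profile bound: `hasTypeIDecay_iff_lerayOrbit`;
* equivariance: `lerayOrbit_apply` and linearity of `g` (`LinearIsometryEquiv.map_smul`);
* nontriviality: `lerayOrbit_neg_log` gives `U(−log(−t₀), √(−t₀)⁻¹ x₀) = √(−t₀) V(t₀, x₀) ≠ 0`.
-/

noncomputable section

-- the summit namespace `…NavierStokesRegularity.NavierStokesRegularity…` is the tree convention (D-0017)
set_option linter.dupNamespace false

namespace Summit.NavierStokesRegularity.NavierStokesRegularity.Theorems.PolyhedralDssProfileExists.PolyhedralCell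

open MeasureTheory Set Function Filter Topology
open Literature.Analysis.FluidPDE

/-- **STUB `stub_lerayOrbitOfRepresentative` (C, line polyhedral_cell): a normalised Oseen-gauge profile
is a periodic `G`-equivariant Type-I orbit of the backward Leray system.** For `V` in the KNSS class
`IsTypeIAncientMild C V`, exactly `c`-DSS (`1 < c`), with `HasTypeIDecay C₀ V`, `G`-equivariant and
nonzero at `(t₀, x₀)`, `t₀ < 0`: the similarity profile `U = lerayOrbit V`, `P = lerayOrbitPressure p`
(`p` a pressure making `V` classical on the past, `exists_isClassicalNSSolutionOn_Iio_of_isTypeIAncientMild`)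
solves the backward Leray system on `ℝ × ℝ³` (`isClassicalNSSolutionOn_Iio_iff_isBackwardLeraySolutionOn`),
is `2 log c`-periodic (`IsDiscretelySelfSimilar.periodic_lerayOrbit`), obeys `(1 + ‖y‖)‖U(s,y)‖ ≤ C₀`
(`hasTypeIDecay_iff_lerayOrbit`), is `G`-equivariant (linearity of `g` through `lerayOrbit_apply`) and
is nonzero at `s = −log(−t₀)`, `y = √(−t₀)⁻¹ x₀` (`lerayOrbit_neg_log`). (Chae–Wolf 2017, §4, proof of
Thm. 1.5: the DSS ⇔ periodicity dictionary; Bradshaw–Tsai 2017, §5.) -/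
theorem stub_lerayOrbitOfRepresentative :
    ∀ (G : Subgroup (EuclideanSpace ℝ (Fin 3) ≃ₗᵢ[ℝ] EuclideanSpace ℝ (Fin 3))) (c : ℝ)
      (V : ℝ → EuclideanSpace ℝ (Fin 3) → EuclideanSpace ℝ (Fin 3)) (C C₀ t₀ : ℝ)
      (x₀ : EuclideanSpace ℝ (Fin 3)),
      1 < c → IsTypeIAncientMild C V → IsDiscretelySelfSimilar c V → HasTypeIDecay C₀ V →
      (∀ g ∈ G, ∀ t x, V t (g x) = g (V t x)) → t₀ < 0 → V t₀ x₀ ≠ 0 →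
      ∃ (U : ℝ → EuclideanSpace ℝ (Fin 3) → EuclideanSpace ℝ (Fin 3))
        (P : ℝ → EuclideanSpace ℝ (Fin 3) → ℝ),
        IsBackwardLeraySolutionOn univ 1 U P ∧ Function.Periodic U (2 * Real.log c) ∧
        (∀ s y, (1 + ‖y‖) * ‖U s y‖ ≤ C₀) ∧
        (∀ g ∈ G, ∀ s y, U s (g y) = g (U s y)) ∧ (∃ s y, U s y ≠ 0) := by
  intro G c V C C₀ t₀ x₀ hc hV hdss hdec heqv ht₀ hne
  -- a pressure making `V` classical on the whole past (KNSS smoothing + de Rham pressure, p152134)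
  obtain ⟨p, hcl⟩ := exists_isClassicalNSSolutionOn_Iio_of_isTypeIAncientMild hV
  refine ⟨lerayOrbit V, lerayOrbitPressure p,
    isClassicalNSSolutionOn_Iio_iff_isBackwardLeraySolutionOn.1 hcl,
    hdss.periodic_lerayOrbit (zero_lt_one.trans hc), hasTypeIDecay_iff_lerayOrbit.1 hdec, ?_, ?_⟩
  · -- equivariance: `g` is linear, so it commutes with both similarity weights
    intro g hg s y
    simp only [lerayOrbit_apply]
    rw [← LinearIsometryEquiv.map_smul, heqv g hg, LinearIsometryEquiv.map_smul]
  · -- nontriviality at `Φ⁻¹(t₀, x₀)`: `U(−log(−t₀), √(−t₀)⁻¹ x₀) = √(−t₀) V(t₀, x₀) ≠ 0`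
    refine ⟨-Real.log (-t₀), (Real.sqrt (-t₀))⁻¹ • x₀, ?_⟩
    rw [lerayOrbit_neg_log V ht₀ x₀]
    exact smul_ne_zero (Real.sqrt_pos.2 (neg_pos.2 ht₀)).ne' hne

end Summit.NavierStokesRegularity.NavierStokesRegularity.Theorems.PolyhedralDssProfileExists.PolyhedralCell

end
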